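import Literature.Topology.FourManifolds.PairPsi
import Literature.Topology.FourManifolds.PairPreExt
import HarnessLib

/-!
# The two-field pre-extension map `psi0` is a pre-extension half: the cone law at the minimum

Topic `Literature/Topology/FourManifolds` (support file for the two-field handle-extension
endgame of `stmt-SmoothPoincare4-15190`, after `PairPsi.lean`, `PairPreExt.lean`).
Everything here is **proved**; the one new definition packages `psi0` as a `PreHalf`.

Milnor, *Lectures on the h-cobordism theorem* (1965), Def. 3.1 (2) and Thm. 4.1: in the radial
Milnor chart at the minimum `p₀` both gradient-like fields of a pair of basin settings are the
radial field, so every **level transport** between the two flows (`PairLevelTransport.lean`)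
**commutes with the scalings of the chart ball** as soon as it serves all the levels of the ball
(`RefData.LT_ofChart_smul`; the case of the level conjugation is
`BasinPair.conj_ofChart_smul`).  Below the saddle value the glued map `psi0` of `PairPsi.lean` is
the level conjugation or an entrance transport, hence **`psi0` satisfies the cone law**
(`SaddleData.psi0_ofChart_smul`), and with the results of `PairPsi.lean` it is a
**pre-extension half** `SaddleData.preHalf : P.PreHalf χ` (`PairPreExt.lean`) whose swapped
half inverts it (`psi0_psi0_swap`).

## References

* J. Milnor, *Lectures on the h-cobordism theorem* (1965), Def. 3.1 (2) (PDF p. 12), Thm. 4.1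
  (PDF p. 22). [MilnorHCobordism1965]
* H. B. Griffiths, *Automorphisms of a 3-dimensional handlebody*, Abh. Math. Sem. Univ. Hamburg
  26 (1964), §§3–6. [GriffithsHB1964Handlebody]
-/

open scoped Manifold ContDiff Topology
open Set Function Filter Metric

noncomputable section

namespace Literature.Topology.FourManifolds

open Cobordism FourManifolds.Flow

universe u

variable {n : ℕ} {W : Type u} [TopologicalSpace W] [T2Space W] [SecondCountableTopology W]
  [CompactSpace W] [ChartedSpace (EuclideanHalfSpace (n + 1)) W] [IsManifold (𝓡∂ (n + 1)) ∞ W]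

namespace BasinPair

variable {g : W → ℝ} {ξA ξB : Π x : W, TangentSpace (𝓡∂ (n + 1)) x} {P : BasinPair g ξA ξB}

/-! ### The cone law for level transports serving the chart ball -/

namespace RefData

variable {R : P.RefData}

/-- **A level transport serving all the levels `(g p₀, sph)` commutes with the scalings of the
common chart ball**: for `v` in the open ball with `ofChart v ∈ R.dom` and `0 < s ≤ 1`,
`LT (ofChart (s • v)) = ofChart (s • toChart (LT (ofChart v)))` (both flows are radial in the
shared chart at `p₀`). [cite: MilnorHCobordism1965, Def. 3.1 (2), Thm. 4.1] -/
theorem LT_ofChart_smul (hI : Ioo (g P.A.p₀) P.A.sph ⊆ R.I₀) {v : EuclideanSpace ℝ (Fin (n + 1))}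
    (hv : ‖v‖ < P.A.r₀) (hxd : P.A.ofChart v ∈ R.dom) {s : ℝ} (hs : 0 < s) (hs1 : s ≤ 1) :
    R.LT (P.A.ofChart (s • v)) = P.A.ofChart (s • P.A.toChart (R.LT (P.A.ofChart v))) := by
  set x := P.A.ofChart v with hx
  have hxsph : g x < P.A.sph := P.A.apply_ofChart_lt_sph hv
  have htx : P.A.toChart x = v := P.A.toChart_ofChart hv.le
  have hv0 : v ≠ 0 := by
    rintro rfl
    exact hxd.2.1 (by rw [hx, P.A.ofChart_zero]; exact P.A.isMCriticalPt_p₀)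
  have hxs : P.A.ofChart (s • v) = P.A.θ (Real.log s, x) := by
    rw [← htx]; exact P.A.ofChart_smul_toChart hxsph hs hs1
  have hsv : ‖s • v‖ < P.A.r₀ := by
    rw [norm_smul, Real.norm_eq_abs, abs_of_pos hs]
    exact lt_of_le_of_lt (mul_le_of_le_one_left (norm_nonneg v) hs1) hv
  have hsv0 : 0 < ‖s • v‖ := norm_pos_iff.2 (smul_ne_zero hs.ne' hv0)
  have hxs_sph : g (P.A.ofChart (s • v)) < P.A.sph := P.A.apply_ofChart_lt_sph hsv
  have hxs_p₀ : g P.A.p₀ < g (P.A.ofChart (s • v)) := by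
    rw [P.A.apply_ofChart hsv.le]; nlinarith
  have hxsd : P.A.ofChart (s • v) ∈ R.dom := by
    rw [hxs] at hxs_sph hxs_p₀ ⊢; exact θ_mem_dom hxd (hI ⟨hxs_p₀, hxs_sph⟩)
  -- the transport `y` of `x`, a flow point of `z = Φ (ref x)` for `ξ_B`
  set z := R.Φ (R.ref x) with hz
  set y := R.LT x with hy
  have hzreg : ¬ IsMCriticalPt (𝓡∂ (n + 1)) g z := not_isMCriticalPt_Φ_ref hxd
  have hy_eq : y = P.B.θ (hittingTime P.B.θ g (g x) z, z) := by rw [hy, LT_def, levelProj_apply]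
  have hgy : g y = g x := apply_LT hxd
  have hyA : g y < P.A.sph := by rw [hgy]; exact hxsph
  have hyB : g y < P.B.sph := by rw [P.sph_eq]; exact hyA
  have hty : ‖P.A.toChart y‖ ^ 2 = g x - g P.A.p₀ := by rw [P.A.norm_toChart_sq hyA.le, hgy]
  -- scaling `y` in the chart is flowing along `ξ_B` (same chart for `B`)
  have hys : P.A.ofChart (s • P.A.toChart y) = P.B.θ (Real.log s + hittingTime P.B.θ g (g x) z, z) := by
    rw [← P.ofChart_eq, ← P.toChart_eq, P.B.ofChart_smul_toChart hyB hs hs1, hy_eq, P.B.θ_add]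
  have hlev : g (P.A.ofChart (s • P.A.toChart y)) = g (P.A.ofChart (s • v)) := by
    have h1 : ‖s • P.A.toChart y‖ ≤ P.A.r₀ := by
      rw [norm_smul, Real.norm_eq_abs, abs_of_pos hs]
      exact (mul_le_of_le_one_left (norm_nonneg _) hs1).trans (P.A.norm_toChart_le hyA.le)
    rw [P.A.apply_ofChart h1, P.A.apply_ofChart hsv.le, norm_smul, norm_smul, mul_pow, mul_pow, hty,
      ← htx, P.A.norm_toChart_sq hxsph.le]
  have hslab : g (P.A.ofChart (s • v)) ∈ Icc P.B.lo P.B.hi := by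
    rw [P.lo_eq, P.hi_eq]
    exact P.A.apply_mem_slab (hxs_sph.trans (P.A.sph_lt_L.trans P.A.L_lt_hi))
  rw [hys] at hlev
  rw [hxs, LT_θ hxd, ← hxs, ← hz, P.B.levelProj_eq_θ_of_apply_eq hzreg hslab hlev, ← hys]

end RefData

namespace SaddleData

variable [Nonempty (BoundaryManifold.boundaryData n W).carrier]
variable {Q : P.SaddleData} {χ χ' : (𝓡∂ (n + 1)).boundary W → (𝓡∂ (n + 1)).boundary W} {δ ρ : ℝ}

omit [Nonempty (BoundaryManifold.boundaryData n W).carrier] in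
/-- Points of the open chart ball other than the apex have level in `(g p₀, sph)`. [folklore] -/
theorem apply_ofChart_mem_Ioo_sph {v : EuclideanSpace ℝ (Fin (n + 1))} (hv : ‖v‖ < P.A.r₀) (hv0 : v ≠ 0) :
    g (P.A.ofChart v) ∈ Ioo (g P.A.p₀) P.A.sph := by
  refine ⟨?_, P.A.apply_ofChart_lt_sph hv⟩
  have h0 : 0 < ‖v‖ := norm_pos_iff.2 hv0
  rw [P.A.apply_ofChart hv.le]; nlinarith

omit [Nonempty (BoundaryManifold.boundaryData n W).carrier] in
/-- **In the chart ball `psi0` is the level conjugation or an entrance transport**: a point of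
level in `(g p₀, sph)` lies in `A.dom` or in the domain of an entrance piece. [folklore] -/
theorem mem_dom_or_exists_mem_dom_refEnt (Q : P.SaddleData) (hδ : 0 < δ) {x : W}
    (hx : g x ∈ Ioo (g P.A.p₀) P.A.sph) : x ∈ P.A.dom ∨ ∃ s, x ∈ (Q.refEnt s δ).dom := by
  have hxI : g x ∈ Ioo (g P.A.p₀) P.A.hi := ⟨hx.1, hx.2.trans (P.A.sph_lt_L.trans P.A.L_lt_hi)⟩
  have hxc : g x < Q.c := hx.2.trans (Q.sph_lt_c_sub_sq.trans (sub_lt_self _ Q.sq_pos))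
  rcases Q.cover (δ₂ := δ) (δ₃ := δ) hδ hδ hxI with h | ⟨s, h⟩ | ⟨s, h⟩ | ⟨s, h⟩
  · exact Or.inl h
  · exact absurd (Q.mem_dom_refExit_iff.1 h).1.1 (not_lt.2 hxc.le)
  · exact Or.inr ⟨s, h⟩
  · exfalso
    have h1 := Q.apply_eq_c s
    rw [← h] at h1
    exact (ne_of_lt hxc) h1

/-- **The cone law for `psi0`**: for `v` in the open chart ball, `v ≠ 0`, and `0 < s ≤ 1`,
`psi0 (ofChart (s • v)) = ofChart (s • toChart (psi0 (ofChart v)))`. [cite: MilnorHCobordism1965, Def. 3.1 (2), Thm. 4.1] [cite: GriffithsHB1964Handlebody, §§3–6] -/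
theorem psi0_ofChart_smul (hA : Q.Adm χ δ ρ) (hχ : ∀ y, χ y ∈ P.B.traces ↔ y ∈ P.A.traces)
    {v : EuclideanSpace ℝ (Fin (n + 1))} (hv : ‖v‖ < P.A.r₀) (hv0 : v ≠ 0) {s : ℝ} (hs : 0 < s) (hs1 : s ≤ 1) :
    Q.psi0 χ δ ρ (P.A.ofChart (s • v)) = P.A.ofChart (s • P.A.toChart (Q.psi0 χ δ ρ (P.A.ofChart v))) := by
  have hxI := apply_ofChart_mem_Ioo_sph (P := P) hv hv0
  have hsv : ‖s • v‖ < P.A.r₀ := by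
    rw [norm_smul, Real.norm_eq_abs, abs_of_pos hs]
    exact lt_of_le_of_lt (mul_le_of_le_one_left (norm_nonneg v) hs1) hv
  have hsv0 : s • v ≠ 0 := smul_ne_zero hs.ne' hv0
  have hxsI := apply_ofChart_mem_Ioo_sph (P := P) hsv hsv0
  have hxs : P.A.ofChart (s • v) = P.A.θ (Real.log s, P.A.ofChart v) := by
    conv_lhs => rw [← P.A.toChart_ofChart hv.le]
    exact P.A.ofChart_smul_toChart hxI.2 hs hs1
  rcases Q.mem_dom_or_exists_mem_dom_refEnt hA.δ_pos hxI with h | ⟨s', h⟩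
  · have hxsd : P.A.ofChart (s • v) ∈ P.A.dom := by
      have h2 := hxsI.2.trans (P.A.sph_lt_L.trans P.A.L_lt_hi)
      rw [hxs] at h2 ⊢
      exact (P.A.θ_mem_dom_iff (hxI.2.trans (P.A.sph_lt_L.trans P.A.L_lt_hi)) h2).2 h
    rw [psi0_eq_conj hxsd, psi0_eq_conj h]
    exact BasinPair.conj_ofChart_smul hχ hv h hs hs1
  · have hI : Ioo (g P.A.p₀) P.A.sph ⊆ (Q.refEnt s' δ).I₀ := fun ℓ hℓ =>
      ⟨hℓ.1, hℓ.2.trans (Q.sph_lt_c_sub_sq.trans (sub_lt_self _ Q.sq_pos))⟩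
    have hxsd : P.A.ofChart (s • v) ∈ (Q.refEnt s' δ).dom := by
      rw [hxs] at hxsI ⊢; exact RefData.θ_mem_dom h (hI hxsI)
    rw [Q.psi0_eq_LT_refEnt hA hxsd, Q.psi0_eq_LT_refEnt hA h]
    exact RefData.LT_ofChart_smul hI hv h hs hs1

/-! ### `psi0` as a pre-extension half -/

variable (Q) in
/-- **The glued map `psi0` is a pre-extension half** for `χ` (admissible widths, `χ` smooth and
mapping traces to traces). [cite: GriffithsHB1964Handlebody, §§3–6] -/
def preHalf (hA : Q.Adm χ δ ρ) (hχs : ContMDiff (𝓡 n) (𝓡 n) ∞ χ)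
    (hχ : ∀ y, χ y ∈ P.B.traces ↔ y ∈ P.A.traces) : P.PreHalf χ where
  ψ := Q.psi0 χ δ ρ
  apply_ψ _ hx := Q.apply_psi0 hA hχ hx
  ψ_p₀ := Q.psi0_p₀ hA
  contMDiffAt_ψ _ hx := Q.contMDiffAt_psi0 hA hχs hχ hx
  ψ_smul _ hv hv0 _ hs hs1 := Q.psi0_ofChart_smul hA hχ hv hv0 hs hs1
  ψ_L _ hw := Q.psi0_of_apply_eq_L hA hw

/-- The map of the pre-extension half is `psi0`. [folklore] -/
@[simp] theorem preHalf_ψ (hA : Q.Adm χ δ ρ) (hχs : ContMDiff (𝓡 n) (𝓡 n) ∞ χ)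
    (hχ : ∀ y, χ y ∈ P.B.traces ↔ y ∈ P.A.traces) : (Q.preHalf hA hχs hχ).ψ = Q.psi0 χ δ ρ := rfl

/-- **The half of the swapped data inverts `psi0` from the right** on `{g p₀ < g < hi}` (levels
of the swapped pair). [cite: GriffithsHB1964Handlebody, §§3–6] -/
theorem psi0_psi0_swap (hA : Q.Adm χ δ ρ) (hχ'' : ∀ y, χ' y ∈ P.A.traces ↔ y ∈ P.B.traces)
    (hχ' : LeftInverse χ' χ) (hχχ' : LeftInverse χ χ') {y : W} (hy : g y ∈ Ioo (g P.swap.A.p₀) P.swap.A.hi) :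
    Q.psi0 χ δ ρ (Q.swap.psi0 χ' δ ρ y) = y := by
  have hA' : Q.swap.Adm χ' δ ρ := hA.swap hχ'
  exact Q.swap.psi0_swap_psi0 hA' hχ'' hχχ' hy

end SaddleData

end BasinPair

end Literature.Topology.FourManifolds
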